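import Literature.MathematicalPhysics.QuantumLattice.FermionQuasiFreeTimeOrderedWick
import Literature.MathematicalPhysics.QuantumLattice.ApproximatingHamiltonianProofs
import Literature.MathematicalPhysics.QuantumLattice.HubbardGaugeBound
import Mathlib.Analysis.InnerProductSpace.Adjoint
import HarnessLib

/-!
# The `n!`-free determinant bound for time-ordered free fermion propagators, from the CAR norm

Topic `MathematicalPhysics/QuantumLattice`; programme under the tree's fact `bgm_two_point_limit`
(`HubbardFermiLiquid.lean`). The convergence of fermionic perturbation theory rests on bounds
`|det G| ≤ Cⁿ` (no `n!`) for the `n × n` matrices of free propagators appearing in the expansion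
(Benfatto–Giuliani–Mastropietro 2006, (2.80); Mastropietro 2008, Lemma 2.2) — usually obtained
from a GRAM representation `G_{ab} = ⟨A_a, B_b⟩` (`GramDeterminantBound`, `FermionQuasiFreeBounds`
for equal times). For propagators at UNEQUAL imaginary times (the entries of
`HubbardLinkedCluster.propMatrix`, with the time-ordering sign switch) a Gram form with
volume-independent constants is the "Matsubara ultraviolet problem" (Pedra–Salmhofer 2008). This
file proves the `n!`-free bound directly from the operator side (the Fock-space argument of
Feldman–Knörrer–Trubowitz / Salmhofer–Wieczerkowski): by the time-ordered Wick theorem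
(`FermionQuasiFreeTimeOrderedWick.gibbsState_dGamma_linWordOp_interleaveWord`) the determinant IS a
free expectation of a word of smeared fields, a state is bounded by the operator norm
(`norm_gibbsState_le`), and `‖c^♯(f)‖ ≤ ‖f‖₂` by the CAR:

* `conjTranspose_linLetterOp`, `norm_linLetterOp_le` — `c^b(f)ᴴ = c^{¬b}(f̄)` and
  **`‖c^b(f)‖ ≤ (Σ_i |f_i|²)^{1/2}`** (`c^b(f)ᴴ c^b(f) + c^b(f) c^b(f)ᴴ = ‖f‖₂² · 1`);
* `norm_linWordOp_le` — `‖word‖ ≤ ∏ ‖letters‖`; `prod_interleaveWord` — an interleaved word is a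
  rearrangement of its letters (products of commuting weights agree);
* **`norm_det_interleave_le`** — for a Hermitian one-body `h`, any `β`, smearing vectors
  `f_a, g_b : ι → ℂ` and ANY interleaving pattern `k` (monotone, `k ≤ n`):
  `|det [ a < k_b ? ⟨c†(f_a) c(g_b)⟩_{β,dΓ(h)} : -⟨c(g_b) c†(f_a)⟩_{β,dΓ(h)} ]_{a,b ≤ n}| ≤ ∏_a ‖f_a‖₂ ∏_b ‖g_b‖₂`.

* `norm_det_timeOrderedPropagator_le`, `sum_sq_norm_col_le_sq_norm`, `sum_sq_norm_row_le_sq_norm`,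
  `norm_det_timeOrderedPropagator_le_prod_norm_exp` — with `f_a`, `g_b` the columns/rows of
  `e^{s_a h}`, `e^{-t_b h}` (imaginary-time evolved fields, `exp_dGamma_conj_creation_eq_linLetterOp`):
  the determinant bound for BGM's time-ordered propagator matrices,
  `|det| ≤ ∏_a ‖e^{s_a h}‖ ∏_b ‖e^{-t_b h}‖` (each factor `≤ e^{|time|‖h‖}`, uniform in the volume for
  the Hubbard torus, `‖h_L‖ ≤ 2d|t| + |μ|`); with tensor-weighted smearings the same argument
  covers the interpolated determinants of the tree expansion.

Everything is PROVED; no definition.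

## References

* J. Feldman, H. Knörrer, E. Trubowitz, *Fermionic Functional Integrals and the Renormalization
  Group*, CRM Monograph Series 16 (AMS 2002), §1.5–1.6 (bounds on Grassmann Gaussian integrals via
  the operator norm on Fock space). [FeldmanKnorrerTrubowitz2002]
* G. Benfatto, A. Giuliani, V. Mastropietro, Ann. Henri Poincaré 7 (2006) 809–898, §2.8 (2.80).
  [BenfattoGiulianiMastropietro2006]
* O. Bratteli, D. W. Robinson, *Operator Algebras and Quantum Statistical Mechanics II*, 2nd ed.
  (Springer 1997), §5.2.1, (5.2.11)–(5.2.12) (`‖a(f)‖ = ‖f‖`). [BratteliRobinsonII1997]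
-/

noncomputable section

open scoped Matrix Matrix.Norms.L2Operator ComplexOrder InnerProductSpace
open Finset NormedSpace

namespace Literature.MathematicalPhysics.QuantumLattice

variable {ι : Type*} [LinearOrder ι] [Fintype ι]

/-! ### The CAR norm of a smeared field -/

omit [Fintype ι] in
/-- The adjoint of a basis letter: `(c^b_i)ᴴ = c^{¬b}_i`. [folklore] -/
theorem conjTranspose_letterOp (i : ι) (b : Bool) :
    (letterOp (i, b) : Matrix (Finset ι) (Finset ι) ℂ)ᴴ = letterOp (i, !b) := by
  cases b
  · simp [letterOp, annihilation_conjTranspose]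
  · simp only [letterOp, if_true, Bool.not_true]
    rw [← annihilation_conjTranspose, Matrix.conjTranspose_conjTranspose]
    rfl

/-- **The adjoint of a smeared field**: `c^b(f)ᴴ = c^{¬b}(f̄)` (coefficients conjugated, type
flipped; the letters are taken linear in `f`). Bratteli–Robinson II §5.2.1. [folklore] -/
theorem conjTranspose_linLetterOp (f : ι → ℂ) (b : Bool) :
    (linLetterOp (f, b))ᴴ = linLetterOp (star f, !b) := by
  simp only [linLetterOp, Matrix.conjTranspose_sum, Matrix.conjTranspose_smul, conjTranspose_letterOp,
    Pi.star_apply]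

/-- The CAR for a smeared field and its adjoint:
`c^b(f)ᴴ c^b(f) + c^b(f) c^b(f)ᴴ = (Σ_i f̄_i f_i) · 1`. Bratteli–Robinson II §5.2.1.
[cite: BratteliRobinsonII1997, §5.2.1] -/
theorem conjTranspose_mul_self_add_self_mul_conjTranspose_linLetterOp (f : ι → ℂ) (b : Bool) :
    (linLetterOp (f, b))ᴴ * linLetterOp (f, b) + linLetterOp (f, b) * (linLetterOp (f, b))ᴴ =
      (∑ i, star (f i) * f i) • (1 : Matrix (Finset ι) (Finset ι) ℂ) := by
  rw [conjTranspose_linLetterOp, linLetterOp_mul_add_mul]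
  congr 1
  simp [linAnticomm]

omit [LinearOrder ι] in
/-- `Σ_i f̄_i f_i = Σ_i |f_i|²` as a complex number. [folklore] -/
theorem sum_star_mul_self_eq (f : ι → ℂ) :
    (∑ i, star (f i) * f i : ℂ) = ((∑ i, ‖f i‖ ^ 2 : ℝ) : ℂ) := by
  simp only [Complex.ofReal_sum, Complex.ofReal_pow]
  refine Finset.sum_congr rfl fun i _ => ?_
  rw [Complex.star_def, Complex.conj_mul']

/-- **The CAR norm bound for smeared fields**: `‖c^b(f)‖ ≤ (Σ_i |f_i|²)^{1/2}` in operator norm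
(from `TᴴT + TTᴴ = ‖f‖² · 1`: `‖Tψ‖² ≤ ‖Tψ‖² + ‖Tᴴψ‖² = ‖f‖²‖ψ‖²`). Bratteli–Robinson II
§5.2.1, (5.2.12): `‖a(f)‖ = ‖f‖`. [cite: BratteliRobinsonII1997, §5.2.1 (5.2.12)] -/
theorem norm_linLetterOp_le (f : ι → ℂ) (b : Bool) :
    ‖linLetterOp (f, b)‖ ≤ Real.sqrt (∑ i, ‖f i‖ ^ 2) := by
  set X : Matrix (Finset ι) (Finset ι) ℂ := linLetterOp (f, b) with hX
  set c : ℝ := ∑ i, ‖f i‖ ^ 2 with hc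
  have hc0 : 0 ≤ c := Finset.sum_nonneg fun i _ => by positivity
  have hCAR : Xᴴ * X + X * Xᴴ = ((c : ℝ) : ℂ) • (1 : Matrix (Finset ι) (Finset ι) ℂ) := by
    rw [hX, conjTranspose_mul_self_add_self_mul_conjTranspose_linLetterOp, sum_star_mul_self_eq]
  -- pass to continuous linear maps on Euclidean space
  set T := Matrix.toEuclideanCLM (n := Finset ι) (𝕜 := ℂ) X with hT
  have hTstar : star T = Matrix.toEuclideanCLM (n := Finset ι) (𝕜 := ℂ) Xᴴ := by
    rw [hT, ← Matrix.star_eq_conjTranspose, map_star]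
  set S := ContinuousLinearMap.adjoint T with hS
  have hTCAR : S * T + T * S = ((c : ℝ) : ℂ) • (1 : EuclideanSpace ℂ (Finset ι) →L[ℂ]
      EuclideanSpace ℂ (Finset ι)) := by
    rw [hS, ← ContinuousLinearMap.star_eq_adjoint, hTstar, hT, ← map_mul, ← map_mul, ← map_add,
      hCAR, map_smul, map_one]
  have hbound : ∀ ψ : EuclideanSpace ℂ (Finset ι), ‖T ψ‖ ≤ Real.sqrt c * ‖ψ‖ := by
    intro ψ
    have h1 : (⟪ψ, (S * T + T * S) ψ⟫_ℂ) = ((c : ℝ) : ℂ) * ⟪ψ, ψ⟫_ℂ := by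
      rw [hTCAR]
      show ⟪ψ, ((c : ℝ) : ℂ) • ψ⟫_ℂ = _
      rw [inner_smul_right]
    have h2 : (⟪ψ, (S * T + T * S) ψ⟫_ℂ) = ⟪T ψ, T ψ⟫_ℂ + ⟪S ψ, S ψ⟫_ℂ := by
      show ⟪ψ, S (T ψ) + T (S ψ)⟫_ℂ = _
      rw [inner_add_right, hS, ContinuousLinearMap.adjoint_inner_right T ψ (T ψ),
        ← ContinuousLinearMap.adjoint_inner_left T ((ContinuousLinearMap.adjoint T) ψ) ψ]
    have h3 : (‖T ψ‖ ^ 2 : ℝ) + ‖S ψ‖ ^ 2 = c * ‖ψ‖ ^ 2 := by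
      have h := congrArg Complex.re (h2.symm.trans h1)
      simp only [Complex.add_re, Complex.re_ofReal_mul] at h
      have e : ∀ x : EuclideanSpace ℂ (Finset ι), (⟪x, x⟫_ℂ).re = ‖x‖ ^ 2 := fun x => by
        rw [← RCLike.re_to_complex]; exact inner_self_eq_norm_sq x
      rw [e, e, e] at h
      exact h
    have h4 : ‖T ψ‖ ^ 2 ≤ (Real.sqrt c * ‖ψ‖) ^ 2 := by
      rw [mul_pow, Real.sq_sqrt hc0]
      nlinarith [sq_nonneg ‖S ψ‖]
    exact (pow_le_pow_iff_left₀ (norm_nonneg _) (by positivity) two_ne_zero).mp h4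
  have hop : ‖T‖ ≤ Real.sqrt c := ContinuousLinearMap.opNorm_le_bound _ (Real.sqrt_nonneg _) hbound
  rwa [hT, ← Matrix.cstar_norm_def] at hop

/-! ### Words of smeared fields -/

/-- **Submultiplicativity**: `‖c^{b₁}(f₁) ⋯ c^{b_r}(f_r)‖ ≤ ∏ ‖c^{bᵢ}(fᵢ)‖`. [folklore] -/
theorem norm_linWordOp_le (w : List (LinLetter ι)) :
    ‖linWordOp w‖ ≤ (w.map fun x => ‖linLetterOp x‖).prod := by
  haveI : Nonempty (Finset ι) := ⟨∅⟩
  rw [linWordOp]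
  refine (List.norm_prod_le _).trans (le_of_eq ?_)
  rw [List.map_map]
  rfl

omit [LinearOrder ι] [Fintype ι] in
/-- **An interleaved word is a rearrangement of its letters**: for a commutative weight `φ`,
`∏_{x ∈ interleaveWord m n u v k} φ(x) = (∏_a φ(u_a)) (∏_b φ(v_b))`. [folklore] -/
theorem prod_map_interleaveWord {X M : Type*} [CommMonoid M] (φ : X → M) :
    ∀ (N m n : ℕ) (u : Fin m → X) (v : Fin n → X) (k : Fin n → ℕ), m + n = N →
      ((interleaveWord m n u v k).map φ).prod = (∏ a, φ (u a)) * ∏ b, φ (v b) := by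
  intro N
  induction N with
  | zero =>
    intro m n u v k hN
    obtain ⟨rfl, rfl⟩ : m = 0 ∧ n = 0 := by omega
    rw [interleaveWord_zero_right]
    simp
  | succ N ih =>
    intro m n u v k hN
    cases m with
    | zero =>
      rw [interleaveWord_zero_left, List.map_ofFn, List.prod_ofFn]
      simp
    | succ m =>
      cases n with
      | zero =>
        rw [interleaveWord_zero_right, List.map_ofFn, List.prod_ofFn]
        simp
      | succ n =>
        rw [interleaveWord_succ_succ]
        split_ifs with h0
        · rw [List.map_cons, List.prod_cons, ih (m + 1) n u (Fin.tail v) (Fin.tail k) (by omega),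
            Fin.prod_univ_succ (fun b => φ (v b))]
          simp only [Fin.tail]
          rw [mul_left_comm]
        · rw [List.map_cons, List.prod_cons, ih m (n + 1) (Fin.tail u) v (fun b => k b - 1) (by omega),
            Fin.prod_univ_succ (fun a => φ (u a)), mul_assoc]
          rfl

omit [LinearOrder ι] [Fintype ι] in
/-- The interleaving sign has modulus one. [folklore] -/
theorem norm_interleaveSign {n : ℕ} (k : Fin n → ℕ) : ‖interleaveSign k‖ = 1 := by
  rw [interleaveSign, norm_pow, norm_neg, norm_one, one_pow]

/-! ### The determinant bound -/

/-- **The `n!`-free determinant bound for time-ordered free two-point matrices, from the CAR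
norm.** For a Hermitian one-body matrix `h`, any inverse temperature `β`, smearing vectors
`f_a, g_b : ι → ℂ` (`a, b < n`) and ANY interleaving pattern `k` (monotone, `k_b ≤ n`: the
creation letter `c†(f_a)` stands to the left of the annihilation letter `c(g_b)` iff `a < k_b`),
`|det [ a < k_b ? ⟨c†(f_a)c(g_b)⟩ : -⟨c(g_b)c†(f_a)⟩ ]_{a,b<n}| ≤ ∏_a ‖f_a‖₂ · ∏_b ‖g_b‖₂`
for the Gibbs state of `dΓ(h)`: the determinant is the free expectation of the interleaved word
(time-ordered Wick theorem), a state is bounded by the operator norm, the norm is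
submultiplicative, and `‖c^♯(f)‖ ≤ ‖f‖₂`. No Gram representation of the (time-ordered!) matrix is
used. Feldman–Knörrer–Trubowitz 2002 §1.5–1.6; BGM 2006 (2.80). [cite: BenfattoGiulianiMastropietro2006, §2.8 (2.80)] -/
theorem norm_det_interleave_le {h : Matrix ι ι ℂ} (hh : h.IsHermitian) (β : ℝ) {n : ℕ}
    (f g : Fin n → ι → ℂ) (k : Fin n → ℕ) (hk : Monotone k) (hkn : ∀ b, k b ≤ n) :
    ‖(Matrix.of fun a b : Fin n =>
        if (a : ℕ) < k b then
          Matrix.gibbsState β (dGamma h) (linLetterOp (f a, true) * linLetterOp (g b, false))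
        else -Matrix.gibbsState β (dGamma h) (linLetterOp (g b, false) * linLetterOp (f a, true))).det‖ ≤
      (∏ a, Real.sqrt (∑ i, ‖f a i‖ ^ 2)) * ∏ b, Real.sqrt (∑ i, ‖g b i‖ ^ 2) := by
  haveI : Nonempty (Finset ι) := ⟨∅⟩
  have hw := gibbsState_dGamma_linWordOp_interleaveWord hh β f g k hk hkn
  -- `‖det‖ = ‖⟨word⟩‖`
  have hnorm : ‖(Matrix.of fun a b : Fin n =>
        if (a : ℕ) < k b then
          Matrix.gibbsState β (dGamma h) (linLetterOp (f a, true) * linLetterOp (g b, false))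
        else -Matrix.gibbsState β (dGamma h) (linLetterOp (g b, false) * linLetterOp (f a, true))).det‖ =
      ‖Matrix.gibbsState β (dGamma h)
        (linWordOp (interleaveWord n n (fun a => (f a, true)) (fun b => (g b, false)) k))‖ := by
    rw [hw, norm_mul, norm_interleaveSign, one_mul]
  rw [hnorm]
  refine (norm_gibbsState_le (isHermitian_dGamma hh) β _).trans ?_
  refine (norm_linWordOp_le _).trans ?_
  rw [prod_map_interleaveWord (fun x : LinLetter ι => ‖linLetterOp x‖) (n + n) n n _ _ k rfl]
  refine mul_le_mul (Finset.prod_le_prod (fun a _ => norm_nonneg _) fun a _ => norm_linLetterOp_le _ _)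
    (Finset.prod_le_prod (fun b _ => norm_nonneg _) fun b _ => norm_linLetterOp_le _ _)
    (Finset.prod_nonneg fun b _ => norm_nonneg _)
    (Finset.prod_nonneg fun a _ => Real.sqrt_nonneg _)

/-- **The determinant bound for BGM's time-ordered free propagator matrices.** For Hermitian `h`,
real `β`, orbitals `i_a, j_b`, complex times `s_a, t_b` and any interleaving pattern `k`
(monotone, `k_b ≤ n`; `a < k_b` iff the creation operator `a⁺_{i_a}(s_a)` stands to the left of
`a⁻_{j_b}(t_b)`), the `n × n` matrix with entries `[e^{-t_b h}(1+e^{βh})⁻¹e^{s_a h}]_{j_b i_a}`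
(`a < k_b`) and `-[e^{-t_b h}(1+e^{-βh})⁻¹e^{s_a h}]_{j_b i_a}` (otherwise) — the propagator matrices of
`HubbardDysonDeterminant` / `HubbardLinkedCluster.propMatrix` and, for general `k`, of their
non-principal minors — satisfies
`|det| ≤ ∏_a ‖(e^{s_a h})_{·, i_a}‖₂ · ∏_b ‖(e^{-t_b h})_{j_b, ·}‖₂`
(columns and rows of the one-body evolutions; each `≤ e^{|time|·‖h‖}`, uniformly in the volume for
a finite-range `h`). No `n!`, no Gram form. [cite: BenfattoGiulianiMastropietro2006, §2.8 (2.80)] -/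
theorem norm_det_timeOrderedPropagator_le {h : Matrix ι ι ℂ} (hh : h.IsHermitian) (β : ℝ) {n : ℕ}
    (i j : Fin n → ι) (s t : Fin n → ℂ) (k : Fin n → ℕ) (hk : Monotone k) (hkn : ∀ b, k b ≤ n) :
    ‖(Matrix.of fun a b : Fin n =>
        if (a : ℕ) < k b then
          (exp (-(t b • h)) * (1 + exp ((β : ℂ) • h))⁻¹ * exp (s a • h)) (j b) (i a)
        else -(exp (-(t b • h)) * (1 + exp (-((β : ℂ) • h)))⁻¹ * exp (s a • h)) (j b) (i a)).det‖ ≤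
      (∏ a, Real.sqrt (∑ m, ‖exp (s a • h) m (i a)‖ ^ 2)) *
        ∏ b, Real.sqrt (∑ m, ‖exp (-(t b • h)) (j b) m‖ ^ 2) := by
  have hM : (Matrix.of fun a b : Fin n =>
        if (a : ℕ) < k b then
          (exp (-(t b • h)) * (1 + exp ((β : ℂ) • h))⁻¹ * exp (s a • h)) (j b) (i a)
        else -(exp (-(t b • h)) * (1 + exp (-((β : ℂ) • h)))⁻¹ * exp (s a • h)) (j b) (i a)) =
      Matrix.of fun a b : Fin n =>
        if (a : ℕ) < k b then
          Matrix.gibbsState β (dGamma h)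
            (linLetterOp (fun m => exp (s a • h) m (i a), true) *
              linLetterOp (fun m => exp (-(t b • h)) (j b) m, false))
        else -Matrix.gibbsState β (dGamma h)
            (linLetterOp (fun m => exp (-(t b • h)) (j b) m, false) *
              linLetterOp (fun m => exp (s a • h) m (i a), true)) := by
    ext a b
    simp only [Matrix.of_apply]
    split_ifs
    · rw [← exp_dGamma_conj_creation_eq_linLetterOp, ← exp_dGamma_conj_annihilation_eq_linLetterOp]
      exact (thermalCorr_dGamma_evolve_creation_annihilation hh β (t b) (s a) (i a) (j b)).symm
    · rw [← exp_dGamma_conj_creation_eq_linLetterOp, ← exp_dGamma_conj_annihilation_eq_linLetterOp]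
      exact congrArg Neg.neg
        (thermalCorr_dGamma_evolve_annihilation_creation hh β (t b) (s a) (i a) (j b)).symm
  rw [hM]
  exact norm_det_interleave_le hh β (fun a m => exp (s a • h) m (i a))
    (fun b m => exp (-(t b • h)) (j b) m) k hk hkn

/-! ### Operator-norm form of the row/column factors -/

section OpNorm

variable {m n : Type*} [Fintype m] [Fintype n] [DecidableEq m] [DecidableEq n]

omit [DecidableEq m] in
/-- **Columns are bounded by the operator norm**: `Σ_i |A_{ij}|² ≤ ‖A‖²` (`ℓ²` operator norm;
`A e_j` is the `j`-th column and `‖e_j‖ = 1`). [folklore] -/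
theorem sum_sq_norm_col_le_sq_norm (A : Matrix m n ℂ) (j : n) :
    ∑ i, ‖A i j‖ ^ 2 ≤ ‖A‖ ^ 2 := by
  set x : EuclideanSpace ℂ n := (EuclideanSpace.equiv n ℂ).symm (Pi.single j 1) with hx
  have hxn : ‖x‖ = 1 := by
    rw [EuclideanSpace.norm_eq]
    have : ∀ i, ‖x i‖ ^ 2 = if i = j then 1 else 0 := by
      intro i
      simp only [hx]
      by_cases hij : i = j
      · subst hij; simp
      · simp [hij]
    simp only [this, Finset.sum_ite_eq', Finset.mem_univ, if_true, Real.sqrt_one]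
  have h := Matrix.l2_opNorm_mulVec A x
  rw [hxn, mul_one] at h
  have hcol : ‖(EuclideanSpace.equiv m ℂ).symm (A *ᵥ x)‖ = Real.sqrt (∑ i, ‖A i j‖ ^ 2) := by
    rw [EuclideanSpace.norm_eq]
    congr 1
    refine Finset.sum_congr rfl fun i _ => ?_
    have : (A *ᵥ (x : n → ℂ)) i = A i j := by
      simp [hx, Matrix.mulVec, dotProduct]
    simp [this]
  rw [hcol] at h
  have h0 : 0 ≤ ∑ i, ‖A i j‖ ^ 2 := Finset.sum_nonneg fun i _ => by positivity
  calc ∑ i, ‖A i j‖ ^ 2 = (Real.sqrt (∑ i, ‖A i j‖ ^ 2)) ^ 2 := (Real.sq_sqrt h0).symm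
    _ ≤ ‖A‖ ^ 2 := by gcongr

/-- **Rows are bounded by the operator norm**: `Σ_j |A_{ij}|² ≤ ‖A‖²` (columns of `Aᴴ`,
`‖Aᴴ‖ = ‖A‖`). [folklore] -/
theorem sum_sq_norm_row_le_sq_norm (A : Matrix m n ℂ) (i : m) :
    ∑ j, ‖A i j‖ ^ 2 ≤ ‖A‖ ^ 2 := by
  have h := sum_sq_norm_col_le_sq_norm Aᴴ i
  simp only [Matrix.conjTranspose_apply, norm_star] at h
  rwa [Matrix.l2_opNorm_conjTranspose] at h

end OpNorm

/-- **The determinant bound with operator norms of the evolutions**: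
`|det| ≤ ∏_a ‖e^{s_a h}‖ · ∏_b ‖e^{-t_b h}‖` for the time-ordered propagator matrices of
`norm_det_timeOrderedPropagator_le` (each factor `≤ e^{|time| ‖h‖}`; for the Hubbard torus
`‖h_L‖ ≤ 2d|t| + |μ|` uniformly in `L`). [cite: BenfattoGiulianiMastropietro2006, §2.8 (2.80)] -/
theorem norm_det_timeOrderedPropagator_le_prod_norm_exp {h : Matrix ι ι ℂ} (hh : h.IsHermitian)
    (β : ℝ) {n : ℕ} (i j : Fin n → ι) (s t : Fin n → ℂ) (k : Fin n → ℕ) (hk : Monotone k)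
    (hkn : ∀ b, k b ≤ n) :
    ‖(Matrix.of fun a b : Fin n =>
        if (a : ℕ) < k b then
          (exp (-(t b • h)) * (1 + exp ((β : ℂ) • h))⁻¹ * exp (s a • h)) (j b) (i a)
        else -(exp (-(t b • h)) * (1 + exp (-((β : ℂ) • h)))⁻¹ * exp (s a • h)) (j b) (i a)).det‖ ≤
      (∏ a, ‖exp (s a • h)‖) * ∏ b, ‖exp (-(t b • h))‖ := by
  refine (norm_det_timeOrderedPropagator_le hh β i j s t k hk hkn).trans ?_
  refine mul_le_mul (Finset.prod_le_prod (fun a _ => Real.sqrt_nonneg _) fun a _ => ?_)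
    (Finset.prod_le_prod (fun b _ => Real.sqrt_nonneg _) fun b _ => ?_)
    (Finset.prod_nonneg fun b _ => Real.sqrt_nonneg _) (Finset.prod_nonneg fun a _ => norm_nonneg _)
  · rw [Real.sqrt_le_left (norm_nonneg _)]
    exact sum_sq_norm_col_le_sq_norm _ _
  · rw [Real.sqrt_le_left (norm_nonneg _)]
    exact sum_sq_norm_row_le_sq_norm _ _

end Literature.MathematicalPhysics.QuantumLattice
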